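import Summits.NavierStokesRegularity.NavierStokesRegularity.Theorems.StrainDoorsLocalNewton
import Summits.NavierStokesRegularity.NavierStokesRegularity.Theorems.StrainDoorsPressureSource
import HarnessLib

/-!
# StrainDoorsFineStructure — locality of the near feed and the FINE-STRUCTURE (isotropic ∕ deviatoric) form of door D8

nsreg-p1 g33 ROUND-46 (cell ns-regularity-ideate, rung N0, helper lane of `stmt-NavierStokesRegularity-0056`;
`--supports 0056 --as helper`).  Everything here is PROVED (std axioms); the only open input of the D8 family stays the
NS-free atom `HessSmoothingEnergyBound` (B3) of `StrainDoorsLocalNewton`.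

§13 LOCALITY (K1(c) of ROUND-45): `newtonNearFeed r₀ r₁ u t x e` depends only on `u(t)` restricted to the ball `B(x, r₁)`
(`newtonNearFeed_eq_of_eqOn_ball`) — the near feed is a genuinely LOCAL functional of the velocity (no pressure, no gauge,
no far field).

§14 FINE-STRUCTURE FORM.  Since `N[∂ₑ∂ₑq] = D²N[q](e,e)` and `ΔN[q] = q − Λ[q]` (tree `laplacian_newtonNearPotential`;
`Λ = newtonFarSmoothing`, the unit-mass shell average), splitting the near Hessian into its ISOTROPIC third and its
TRACE-FREE part `TF_ee := D²N[q](e,e) − ⅓ΔN[q]` (`tfNearHess`; `∑ᵢ TF_{bᵢbᵢ} = 0` over every orthonormal basis: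
`sum_tfNearHess_orthonormalBasis_eq_zero`) gives, with `q = ½|ω|² − |S|²`, the kernel-checked identity
  `newtonNearFeed = (1/12)|ω|² − ¼ω_e² + ⅓|S|² + ⅓Λ[q](x) − TF_ee(x)`   (`newtonNearFeed_eq_fineStructureFeed`),
so the D8 hypothesis `newtonNearFeed ≤ λ_max²` at a charged almost-maximiser reads
  `(⅓|S|² − λ_max²) + ((1/12)|ω|² − ¼ω_e²) + ⅓Λ_{r₀r₁}[½|ω|² − |S|²](x) ≤ TF_ee(x)`
— [sheet∕tube indicator: at an exact argmax `⅓|S|² − λ² = ⅓(2λ₂² + 2λλ₂ − λ²)`, positive iff the middle eigenvalue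
`λ₂ > (√3−1)λ/2`] + [vorticity MISalignment with the stretching direction: `−⅙|ω|²` if `ω ∥ e`, `+(1/12)|ω|²` if `ω ⊥ e`]
+ [shell average of `q` at scale `r₀ < |z| < r₁`] ≤ [deviatoric near-CZ term = quadrupolar anisotropy of `q` around `x`].
This is the localised (cut-off) form of the isotropic∕deviatoric split of the pressure Hessian (restricted-Euler part vs.
non-local part, Vieillefosse 1982 ∕ Ohkitani–Kishiba 1995), typed as door D8′ `FineStructureParityDoor` with
`fineStructureParityDoor_of_B3 : HessSmoothingEnergyBound → FineStructureParityDoor`.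
HONEST FRAME: a CONDITIONAL continuation criterion (same logical strength as D8); 0056 `NoTypeII` / 10661 / NS regularity
NOT proved; no hard core touched.
-/

noncomputable section

open MeasureTheory Set Function Filter Metric Real InnerProductSpace intervalIntegral
open _root_.Topology
open scoped ENNReal NNReal RealInnerProductSpace ContDiff Laplacian
open Literature.Analysis Literature.Analysis.FluidPDE

set_option linter.dupNamespace false

namespace Summit.NavierStokesRegularity.NavierStokesRegularity.Theorems.StrainDoors

/-! ## §13  K1(c) — LOCALITY of the D8 hypothesis (kernel-checked): `newtonNearFeed r₀ r₁ u t x e` is determined by `u t` on the OPEN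
ball `B(x,r₁)`; in particular D8 is not a restatement of D5/D7, whose feeds see the whole field through the pressure. -/

/-- `qDensity` depends on the germ of the field at the point. -/
theorem qDensity_eq_of_eventuallyEq {u₁ u₂ : ℝ → (EuclideanSpace ℝ (Fin 3)) → (EuclideanSpace ℝ (Fin 3))} {t : ℝ}
    {y : EuclideanSpace ℝ (Fin 3)} (h : u₁ t =ᶠ[𝓝 y] u₂ t) : qDensity u₁ t y = qDensity u₂ t y := by
  unfold qDensity strainNormSq curl
  rw [h.fderiv_eq]

/-- fields agreeing on a ball have the same `qDensity` near its centre. -/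
theorem qDensity_eventuallyEq_of_eqOn_ball {u₁ u₂ : ℝ → (EuclideanSpace ℝ (Fin 3)) → (EuclideanSpace ℝ (Fin 3))} {t : ℝ}
    {x : EuclideanSpace ℝ (Fin 3)} {ρ : ℝ} (h : EqOn (u₁ t) (u₂ t) (ball x ρ)) {w : EuclideanSpace ℝ (Fin 3)} (hw : w ∈ ball x ρ) :
    qDensity u₁ t =ᶠ[𝓝 w] qDensity u₂ t := by
  filter_upwards [isOpen_ball.mem_nhds hw] with y hy
  exact qDensity_eq_of_eventuallyEq (Filter.eventuallyEq_of_mem (isOpen_ball.mem_nhds hy) h)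

/-- …and the same second derivatives of `qDensity` at the centre. -/
theorem fderiv_fderiv_qDensity_eq_of_eqOn_ball {u₁ u₂ : ℝ → (EuclideanSpace ℝ (Fin 3)) → (EuclideanSpace ℝ (Fin 3))} {t : ℝ}
    {x : EuclideanSpace ℝ (Fin 3)} {ρ : ℝ} (h : EqOn (u₁ t) (u₂ t) (ball x ρ)) {w : EuclideanSpace ℝ (Fin 3)} (hw : w ∈ ball x ρ)
    (e : EuclideanSpace ℝ (Fin 3)) :
    fderiv ℝ (fun y => fderiv ℝ (qDensity u₁ t) y e) w e = fderiv ℝ (fun y => fderiv ℝ (qDensity u₂ t) y e) w e := by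
  have hev : (fun y => fderiv ℝ (qDensity u₁ t) y e) =ᶠ[𝓝 w] (fun y => fderiv ℝ (qDensity u₂ t) y e) := by
    filter_upwards [isOpen_ball.mem_nhds hw] with y hy
    rw [(qDensity_eventuallyEq_of_eqOn_ball h hy).fderiv_eq]
  rw [hev.fderiv_eq]

/-- ★ K1(c): the D8 feed at `x` depends on `u(t)` only through its restriction to the open ball `B(x,r₁)`. -/
theorem newtonNearFeed_eq_of_eqOn_ball {r₀ r₁ : ℝ} (hr₀ : 0 ≤ r₀) (hr₁ : r₀ < r₁)
    {u₁ u₂ : ℝ → (EuclideanSpace ℝ (Fin 3)) → (EuclideanSpace ℝ (Fin 3))} {t : ℝ} {x : EuclideanSpace ℝ (Fin 3)}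
    (h : EqOn (u₁ t) (u₂ t) (ball x r₁)) (e : EuclideanSpace ℝ (Fin 3)) :
    newtonNearFeed r₀ r₁ u₁ t x e = newtonNearFeed r₀ r₁ u₂ t x e := by
  have hx : x ∈ ball x r₁ := mem_ball_self (lt_of_le_of_lt hr₀ hr₁)
  have hcurl : curl (u₁ t) x = curl (u₂ t) x := by
    unfold curl; rw [(Filter.eventuallyEq_of_mem (isOpen_ball.mem_nhds hx) h).fderiv_eq]
  have hN : newtonNearPotential r₀ r₁ (fun w => fderiv ℝ (fun y => fderiv ℝ (qDensity u₁ t) y e) w e) x =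
      newtonNearPotential r₀ r₁ (fun w => fderiv ℝ (fun y => fderiv ℝ (qDensity u₂ t) y e) w e) x := by
    unfold newtonNearPotential
    refine integral_congr_ae (ae_of_all _ fun z => ?_)
    by_cases hz : r₁ ≤ ‖z‖
    · simp only [newtonNear_eq_zero hr₀ hr₁ hz, zero_mul]
    · have hw : x - z ∈ ball x r₁ := by
        rw [mem_ball, dist_eq_norm, sub_sub_cancel_left, norm_neg]; exact lt_of_not_ge hz
      simp only [fderiv_fderiv_qDensity_eq_of_eqOn_ball h hw e]
  unfold newtonNearFeed
  rw [hcurl, hN]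


/-! ## §14  FINE-STRUCTURE FORM of the D8 hypothesis (kernel-checked identity; ROUND-46 core).
Since `N[∂ₑ∂ₑq] = D²N[q](e,e)` and `ΔN[q] = q − Λ[q]` (tree `laplacian_newtonNearPotential`; `Λ` = the unit-mass shell average
`newtonFarSmoothing`), splitting the near Hessian into its ISOTROPIC third and its TRACE-FREE (deviatoric, Calderón–Zygmund) part gives,
with `q = ½|ω|² − |S|²`,
  `newtonNearFeed = (1/12)|ω|² − ¼ω_e² + ⅓|S|² + ⅓Λ[q](x) − TF_ee(x)`,
so the D8 hypothesis `newtonNearFeed ≤ λ_max²` reads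
  `(⅓|S|² − λ_max²) + ((1/12)|ω|² − ¼ω_e²) + ⅓Λ_{r₀r₁}[½|ω|² − |S|²](x) ≤ TF_ee(x)`:
[sheet/tube indicator of the strain at the maximiser: at an exact argmax `⅓|S|² − λ² = ⅓(2λ₂² + 2λλ₂ − λ²)`, positive iff the middle
eigenvalue `λ₂ > (√3−1)λ/2`] + [vorticity MISalignment with the stretching direction: `−⅙|ω|²` if `ω ∥ e`, `+(1/12)|ω|²` if `ω ⊥ e`]
+ [shell average of `½|ω|² − |S|²` around `x`: negative in strain-dominated surroundings] ≤ [deviatoric CZ near term = quadrupolar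
anisotropy of `q` around `x` at scales `≤ r₁`]. -/

/-- the unit-mass SHELL AVERAGE `Λ_{r₀r₁}[q(t)](x) = ∫ λ(z) q(t, x − z) dz` of `q = ½|ω|² − |S|²` (tree `newtonFarSmoothing`, `∫ λ = 1`). -/
def shellAverage (r₀ r₁ : ℝ) (u : ℝ → (EuclideanSpace ℝ (Fin 3)) → (EuclideanSpace ℝ (Fin 3))) (t : ℝ)
    (x : EuclideanSpace ℝ (Fin 3)) : ℝ :=
  newtonFarSmoothing r₀ r₁ (qDensity u t) x

/-- the TRACE-FREE (deviatoric) part of the near Hessian along `e`: `TF_ee(x) = D²N[q](x)(e,e) − ⅓ΔN[q](x)`. -/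
def tfNearHess (r₀ r₁ : ℝ) (u : ℝ → (EuclideanSpace ℝ (Fin 3)) → (EuclideanSpace ℝ (Fin 3))) (t : ℝ)
    (x e : EuclideanSpace ℝ (Fin 3)) : ℝ :=
  newtonNearPotential r₀ r₁ (fun w => fderiv ℝ (fun y => fderiv ℝ (qDensity u t) y e) w e) x -
    (1 / 3) * (Δ (newtonNearPotential r₀ r₁ (qDensity u t))) x

/-- the FINE-STRUCTURE FEED: `(1/12)|ω|² − ¼ω_e² + ⅓|S|² + ⅓Λ[q](x) − TF_ee(x)`. -/
def fineStructureFeed (r₀ r₁ : ℝ) (u : ℝ → (EuclideanSpace ℝ (Fin 3)) → (EuclideanSpace ℝ (Fin 3))) (t : ℝ)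
    (x e : EuclideanSpace ℝ (Fin 3)) : ℝ :=
  (1 / 12) * ‖curl (u t) x‖ ^ 2 - (1 / 4) * ⟪curl (u t) x, e⟫ ^ 2 + (1 / 3) * strainNormSq u t x +
    (1 / 3) * shellAverage r₀ r₁ u t x - tfNearHess r₀ r₁ u t x e

/-- ★ the identity `newtonNearFeed = fineStructureFeed` in the door frame (every `t ∈ [0,T)`, every `x`, `e`). -/
theorem newtonNearFeed_eq_fineStructureFeed {ν T : ℝ} {u : ℝ → (EuclideanSpace ℝ (Fin 3)) → (EuclideanSpace ℝ (Fin 3))}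
    {p : ℝ → (EuclideanSpace ℝ (Fin 3)) → ℝ} (hsol : IsClassicalNSSolutionOn (Ico 0 T) ν 0 u p) {t : ℝ} (ht : t ∈ Ico 0 T)
    {r₀ r₁ : ℝ} (hr₀ : 0 < r₀) (hr₁ : r₀ < r₁) (x e : EuclideanSpace ℝ (Fin 3)) :
    newtonNearFeed r₀ r₁ u t x e = fineStructureFeed r₀ r₁ u t x e := by
  have hS : UniqueDiffOn ℝ (Ico (0 : ℝ) T) := uniqueDiffOn_Ico 0 T
  have hΔs : ContDiff ℝ ∞ (fun y => (Δ (p t)) y) := (hsol.smooth_pressure.laplacian hS).contDiff_slice ht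
  have hq : qDensity u t = fun y => (Δ (p t)) y := qDensity_eq_laplacian_pressure_fun hsol ht
  have hq2 : ContDiff ℝ 2 (qDensity u t) := hq ▸ contDiff_infty.1 hΔs 2
  have hL : (Δ (newtonNearPotential r₀ r₁ (qDensity u t))) x = qDensity u t x - shellAverage r₀ r₁ u t x :=
    laplacian_newtonNearPotential hr₀ hr₁ hq2 x
  have hqx : qDensity u t x = (1 / 2) * ‖curl (u t) x‖ ^ 2 - strainNormSq u t x := rfl
  unfold fineStructureFeed tfNearHess newtonNearFeed
  rw [hL, hqx]
  ring

/-- DOOR D8′ «FineStructureParityDoor» (the SAME door as D8, hypothesis rewritten): if on `[t₀,T)` at every `δ`-almost strain maximiser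
above level `l₀`  `(⅓|S|² − λ_max²) + ((1/12)|ω|² − ¼ω_e²) + ⅓Λ_{r₀r₁}[½|ω|² − |S|²](x) ≤ TF_ee(x)`, the solution continues past `T`. -/
def FineStructureParityDoor : Prop :=
  ∀ (ν T t₀ l₀ δ r₀ r₁ : ℝ), 0 < ν → 0 ≤ t₀ → t₀ < T → 0 < l₀ → 0 < δ → δ < 1 → 0 < r₀ → r₀ < r₁ →
    ∀ (u : ℝ → (EuclideanSpace ℝ (Fin 3)) → (EuclideanSpace ℝ (Fin 3)))
      (p : ℝ → (EuclideanSpace ℝ (Fin 3)) → ℝ),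
      IsClassicalNSSolutionOn (Ico 0 T) ν 0 u p →
      (∀ T'' < T, HasBoundedSobolevNormsOn (Icc 0 T'') u) →
      (∀ t ∈ Ico t₀ T, ∀ (x e : EuclideanSpace ℝ (Fin 3)), IsStrainAlmostArgmax δ u t x e → l₀ < strainQuad u t x e →
        ((1 / 3) * strainNormSq u t x - strainQuad u t x e ^ 2) +
          ((1 / 12) * ‖curl (u t) x‖ ^ 2 - (1 / 4) * ⟪curl (u t) x, e⟫ ^ 2) +
          (1 / 3) * shellAverage r₀ r₁ u t x ≤ tfNearHess r₀ r₁ u t x e) →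
      HasSobolevExtensionPast ν u T

/-- D8 ⇒ D8′ (the hypothesis is rewritten by the fine-structure identity). -/
theorem fineStructureParityDoor_of_D8 (h8 : LocalNewtonParityDoor) : FineStructureParityDoor := by
  intro ν T t₀ l₀ δ r₀ r₁ hν ht₀ hT hl₀ hδ hδ1 hr₀ hr₁ u p hsol hSob hhyp
  refine h8 ν T t₀ l₀ δ r₀ r₁ hν ht₀ hT hl₀ hδ hδ1 hr₀ hr₁ u p hsol hSob fun t ht x e hx hl => ?_
  have h := hhyp t ht x e hx hl
  rw [newtonNearFeed_eq_fineStructureFeed hsol ⟨ht₀.trans ht.1, ht.2⟩ hr₀ hr₁ x e]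
  unfold fineStructureFeed
  linarith

/-- ★★ D8′ from the single NS-free atom B3. -/
theorem fineStructureParityDoor_of_B3 (h3 : HessSmoothingEnergyBound) : FineStructureParityDoor :=
  fineStructureParityDoor_of_D8 (localNewtonParityDoor_of_B3 h3)


/-- `TF` IS the deviatoric part (vacuity guard): over any orthonormal basis `b` of `ℝ³`, `∑ᵢ TF_{bᵢbᵢ}(x) = 0` in the door frame. -/
theorem sum_tfNearHess_orthonormalBasis_eq_zero {ν T : ℝ} {u : ℝ → (EuclideanSpace ℝ (Fin 3)) → (EuclideanSpace ℝ (Fin 3))}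
    {p : ℝ → (EuclideanSpace ℝ (Fin 3)) → ℝ} (hsol : IsClassicalNSSolutionOn (Ico 0 T) ν 0 u p) {t : ℝ} (ht : t ∈ Ico 0 T)
    {r₀ r₁ : ℝ} (hr₀ : 0 < r₀) (hr₁ : r₀ < r₁) (x : EuclideanSpace ℝ (Fin 3)) {ι : Type*} [Fintype ι]
    (b : OrthonormalBasis ι ℝ (EuclideanSpace ℝ (Fin 3))) :
    ∑ i, tfNearHess r₀ r₁ u t x (b i) = 0 := by
  have hS : UniqueDiffOn ℝ (Ico (0 : ℝ) T) := uniqueDiffOn_Ico 0 T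
  have hΔs : ContDiff ℝ ∞ (fun y => (Δ (p t)) y) := (hsol.smooth_pressure.laplacian hS).contDiff_slice ht
  have hq : qDensity u t = fun y => (Δ (p t)) y := qDensity_eq_laplacian_pressure_fun hsol ht
  have hq2 : ContDiff ℝ 2 (qDensity u t) := hq ▸ contDiff_infty.1 hΔs 2
  set N : (EuclideanSpace ℝ (Fin 3)) → ℝ := newtonNearPotential r₀ r₁ (qDensity u t) with hN
  have hN2 : ContDiff ℝ 2 N := contDiff_newtonNearPotential hr₀.le hr₁ 2 hq2
  have hdN : DifferentiableAt ℝ (fderiv ℝ N) x :=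
    ((hN2.fderiv_right (m := 1) (by norm_num)).differentiable one_ne_zero).differentiableAt
  -- each diagonal entry of `D²N[q]` is `N[∂ₐ∂ₐ q]`
  have hentry : ∀ a : EuclideanSpace ℝ (Fin 3),
      newtonNearPotential r₀ r₁ (fun w => fderiv ℝ (fun y => fderiv ℝ (qDensity u t) y a) w a) x =
        iteratedFDeriv ℝ 2 N x ![a, a] := fun a => by
    rw [← fderiv_fderiv_newtonNearPotential_apply hr₀.le hr₁ hq2 x a a, iteratedFDeriv_two_apply,
      fderiv_clm_apply hdN (differentiableAt_const a)]
    simp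
  have hΔ : (Δ N) x = ∑ i, iteratedFDeriv ℝ 2 N x ![b i, b i] :=
    congrFun (laplacian_eq_iteratedFDeriv_orthonormalBasis N b) x
  have hcard : Fintype.card ι = 3 := by
    rw [← Module.finrank_eq_card_basis b.toBasis, finrank_euclideanSpace_fin]
  unfold tfNearHess
  simp_rw [hentry]
  rw [Finset.sum_sub_distrib, Finset.sum_const, Finset.card_univ, hcard, ← hΔ]
  simp only [nsmul_eq_mul, Nat.cast_ofNat]
  ring


end Summit.NavierStokesRegularity.NavierStokesRegularity.Theorems.StrainDoors
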